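import Summits.BirchSwinnertonDyer.Rank1Residual.Additive.StrictSignedSelmerPreimageZero
import Summits.BirchSwinnertonDyer.Rank1Residual.Additive.CyclotomicTowerGlobalTorsion
import Literature.NumberTheory.EllipticCurves.HasseWeilGoodReduction
import Literature.NumberTheory.EllipticCurves.SelmerPInftyRelModelAction
import HarnessLib

/-!
# Brick B2 HYPOTHESIS-FREE for a good supersingular curve at `E = ℚ_p`:
# `h₀⁻¹(Sel^{ε,str}(E/K_∞))` = the classes over `K` satisfying the level-`∞` local conditions, for
# Kobayashi's own signed Selmer groups (cell `b2b-bsdres`, CLASS-CLOSURE lane, class O10 — x1b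
# GEN 35, class lead; file 48 of the series: brick B2 of the GLOBAL count (C), part 5 — the
# hypotheses (hS), (htors) of file 47 DISCHARGED at `ℚ_p` for good supersingular reduction, `p` odd)

HONEST FRAMING (cell `b2b-bsdres`, run/shared/lean/b2b/bsd-rank1-residual/, verbatim in every
file): the goal of the cell is to DELETE the COMBINATION-SHAPED residual classes of the
Birch–Swinnerton-Dyer formula for ALL analytic-rank `≤ 1` elliptic curves over `ℚ` — "full BSD
formula for every rank `≤ 1` curve in class `C`" assembled STRICTLY from published theorems — so
that the rank-`≤ 1` remainder becomes exactly the CONSTRUCTION-SHAPED classes, which are TYPED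
(missing-input `Prop`s), NOT attempted. This is not "finishing BSD". CLASS-CLOSURE lane: prove
what is provable now; shrink each hard class to its core with data; no claim beyond stated classes;
research routes on CONSTRUCTION-SHAPED X12 / O10; census / instrument output = EVIDENCE / conjecture
items, NEVER a Literature fact; `RESIDUAL-MAP.md` marks change only by signed lines. THIS FILE:
TOOL THEOREMS ONLY (instances of file 47 with gen 32's Prop. 8.7 and the finiteness of the bad
places) — no definition, no named Literature fact, no Summits-side fact `def … : Prop`, no `sorry`,
axioms standard; nothing is booked; no label / mark / count / sub-cell moves; (C1_η), (C2_η-GZ),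
(C3_η) stay typed as filed; O10 stays OPEN / CONSTRUCTION-SHAPED; nothing about `BSD(W, p)` of any
pair is claimed.

## What

File 47 (`StrictSignedSelmerPreimageZero`) proved `A₀ = A₀'` — `h₀⁻¹(Sel^{ε,str}(E/K_∞))` is the
group of classes over `K` satisfying the LEVEL-`∞` local conditions — under (hS) "`S ⊇ {v ∣ p} ∪
{bad v}` finite" and (htors) "`E(K_∞·E)[p^∞] = 0`". Here both are DISCHARGED for the model `E = ℚ_p`:

* §1 `exists_finset_forall_not_mem_good`: for an elliptic curve over a number field there IS a
  finite set of finite places outside which every place is prime to `p` and of good reduction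
  (finiteness of the bad places, `eventually_hasGoodReductionAt` = Silverman VIII.1.3, and of the
  places above `p`, Mathlib `Ideal.finite_factors`).
* §2 `eq_zero_of_prime_pow_smul_eq_zero_localFixedPointsOfEmb_kerSubgroup_padic`: (htors) at
  `ι : K̄ → ℚ̄_p` for `W` with a good supersingular `ℤ_p`-model (`Δ` a unit, `A_p ∈ pℤ_p`,
  `M ⊗ ℚ̄_p = W ⊗ ℚ̄_p`), `p ≥ 3`: the points of `W(ℚ̄_p)` fixed by `Gal(ℚ̄_p/K_∞·ℚ_p)` have no
  `p`-power torsion — gen 32's Prop. 8.7 at the top of the tower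
  (`eq_zero_of_prime_pow_smul_eq_zero_localFixedPointsOfEmb_towerTopSubgroup_padic` with `K₀ = K`,
  `towerTopSubgroup κ K ≤ ker κ`); `_of_goodSupersingular`: for `W ⊗ ℚ̄_p = V ⊗ ℚ̄_p`, `V/ℚ` globally
  minimal with good reduction at `p` and `a_p(V) = 0` (gen 32's `exists_goodSupersingularPadicModel`).
* §3 **`comap_layerToInfty_zero_strictSignedSelmerInfty_eq_padic` / `_of_goodSupersingular`**:
  `A₀ = A₀'` at `E = ℚ_p` with NO auxiliary hypothesis — for every `K` with `K → ℚ_p`, every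
  `ℤ_p`-extension `κ`, every sign `ε`, `p ≥ 3`, and `W/K` good supersingular at the place of the
  embedding in the above sense. For `K = ℚ`, `κ` cyclotomic, `ε = ±1` these are Kobayashi's
  `Sel^±(E/ℚ_∞) = lim→ Sel^±(E/ℚ_n)` ([K] Def. 1.1 / 2.1; on the plus side the strict clause is void,
  `strictSignedLocalPointsOfEmb_one`): **the direct limit pulls back to `ℚ` as the Selmer group of
  the pulled-back level-`∞` signed condition** (PAPER: implicit in [K] §9, proof of Thm. 9.3).
  The TWIST `W = V ⊗ η` of the (C3_η) derivation is NOT covered here (`W ⊗ ℚ̄_p = V ⊗ ℚ̄_p` fails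
  for the twisted equation; (htors) for the twist needs the twist dictionary on `ℚ̄_p`-points,
  n1011's (D3)).

References: [Kobayashi2003] S. Kobayashi, Invent. Math. 152 (2003), Def. 1.1 (p. 2), Def. 2.1 (p. 5),
Prop. 8.7 (p. 16), Lemma 9.1 (p. 25), Thm. 9.3 (p. 26); [GreenbergLNM1716] §3 pp. 85–90;
[SilvermanAEC2009] Rem. VIII.1.3.
-/

noncomputable section

open scoped Classical

open NumberField IsDedekindDomain

namespace Summit.BirchSwinnertonDyer.Rank1Residual.Additive

open Literature.NumberTheory.EllipticCurves Literature.NumberTheory.GaloisRepresentations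
  Literature.NumberTheory.EllipticCurves.Kobayashi2003 ZpExtension WeierstrassCurve

/-! ## §1 A finite set of places containing the bad places and the places above `p` -/

section Places

variable {K : Type*} [Field K] [NumberField K] (W : WeierstrassCurve K) (p : ℕ) [hp : Fact p.Prime]

/-- **(hS) discharged**: for an elliptic curve over a number field there is a finite set `S` of
finite places such that every `v ∉ S` is prime to `p` and of good reduction (the bad places are
finite — Silverman VIII.1.3, tree `eventually_hasGoodReductionAt` — and so are the places above `p`,
Mathlib `Ideal.finite_factors`). [cite: SilvermanAEC2009, Rem. VIII.1.3] -/
theorem exists_finset_forall_not_mem_good [W.IsElliptic] :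
    ∃ S : Finset (HeightOneSpectrum (𝓞 K)), ∀ v ∉ S, (p : 𝓞 K) ∉ v.asIdeal ∧ W.HasGoodReductionAt v := by
  have h1 : {v : HeightOneSpectrum (𝓞 K) | ¬ W.HasGoodReductionAt v}.Finite :=
    Filter.eventually_cofinite.mp W.eventually_hasGoodReductionAt
  have hp0 : Ideal.span {(p : 𝓞 K)} ≠ ⊥ := by
    rw [Ne, Ideal.span_singleton_eq_bot]
    exact_mod_cast hp.out.ne_zero
  have h2 : {v : HeightOneSpectrum (𝓞 K) | (p : 𝓞 K) ∈ v.asIdeal}.Finite :=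
    (Ideal.finite_factors hp0).subset fun v hv ↦ Ideal.dvd_span_singleton.mpr hv
  refine ⟨(h1.union h2).toFinset, fun v hv ↦ ?_⟩
  rw [Set.Finite.mem_toFinset, Set.mem_union, not_or] at hv
  exact ⟨hv.2, not_not.mp hv.1⟩

end Places

/-! ## §2 (htors) at `E = ℚ_p` for good supersingular reduction: `E(K_∞·ℚ_p)[p^∞] = 0` -/

section Torsion

variable {p : ℕ} [hp : Fact p.Prime] {K : Type} [Field K] [NumberField K] [Algebra K ℚ_[p]]
  (κ : ZpExtension K p) (ι : AlgebraicClosure K →ₐ[K] AlgebraicClosure ℚ_[p])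
  (W : WeierstrassCurve K) [W.IsElliptic]

/-- **`E(K_∞·ℚ_p)[p^∞] = 0` for a good supersingular `ℤ_p`-model, `p ≥ 3`** — hypothesis (htors) of
file 47 at `ι : K̄ → ℚ̄_p`: a point of `W(ℚ̄_p)` fixed by `Gal(ℚ̄_p/K_∞·ℚ_p)` (`(ker κ)_{ℚ_p}`) and killed
by a power of `p` is `0`. From gen 32's Prop. 8.7 at the top of the tower with `K₀ = K`
(`towerTopSubgroup κ K ≤ ker κ`, `localFixedPointsOfEmb_antitone`; `[K : K] = 1 < (p² − 1)/2`).
[cite: Kobayashi2003, Prop. 8.7 (p. 16)] -/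
theorem eq_zero_of_prime_pow_smul_eq_zero_localFixedPointsOfEmb_kerSubgroup_padic (hp2 : p ≠ 2)
    (M : WeierstrassCurve ℤ_[p]) (hΔ : IsUnit M.Δ)
    (hA : M.hasseCoeff p ∈ IsLocalRing.maximalIdeal ℤ_[p])
    (hWM : M.baseChange (AlgebraicClosure ℚ_[p]) = W.baseChange (AlgebraicClosure ℚ_[p])) :
    ∀ P : localPoints W ℚ_[p], P ∈ localFixedPointsOfEmb ι W κ.kerSubgroup →
      (∃ j : ℕ, p ^ j • P = 0) → P = 0 := by
  haveI : (galRange (K := K) K).Normal := RelModel.normal_galRange (K := K) K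
  have hlt : Module.finrank K K < (p ^ 2 - 1) / 2 := by
    rw [Module.finrank_self]
    have hp3 : 3 ≤ p := by
      rcases Nat.lt_or_ge p 3 with h | h
      · exfalso
        interval_cases p
        · exact hp.out.ne_zero rfl
        · exact hp.out.ne_one rfl
        · exact hp2 rfl
      · exact h
    have h9 : 9 ≤ p ^ 2 := by nlinarith
    omega
  obtain ⟨hK0, hK⟩ := index_galRange_ne_zero_and_lt (p := p) (K := K) K hlt
  rintro P hP ⟨j, hj⟩
  exact eq_zero_of_prime_pow_smul_eq_zero_localFixedPointsOfEmb_towerTopSubgroup_padic κ K ι W hp2 M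
    hΔ hA hWM hK0 hK j P
    (localFixedPointsOfEmb_antitone ι W (towerTopSubgroup_le_kerSubgroup κ K) hP) hj

/-- **`E(K_∞·ℚ_p)[p^∞] = 0` for a globally minimal good supersingular `V/ℚ` read over `K`**
(`W ⊗ ℚ̄_p = V ⊗ ℚ̄_p`, `V.HasGoodReductionAtPrime p`, `a_p(V) = 0`, `p ≥ 3`; gen 32's
`exists_goodSupersingularPadicModel`). [cite: Kobayashi2003, Prop. 8.7 (p. 16)] -/
theorem eq_zero_of_prime_pow_smul_eq_zero_localFixedPointsOfEmb_kerSubgroup_of_goodSupersingular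
    (hp2 : p ≠ 2) (V : WeierstrassCurve ℚ) [V.IsElliptic] [V.IsGloballyMinimal]
    (hgood : V.HasGoodReductionAtPrime p) (hap : V.frobeniusTrace p = 0)
    (hWV : W.baseChange (AlgebraicClosure ℚ_[p]) = V.baseChange (AlgebraicClosure ℚ_[p])) :
    ∀ P : localPoints W ℚ_[p], P ∈ localFixedPointsOfEmb ι W κ.kerSubgroup →
      (∃ j : ℕ, p ^ j • P = 0) → P = 0 := by
  obtain ⟨M, hΔ, hA, hVM⟩ := exists_goodSupersingularPadicModel hp2 V hgood hap
  exact eq_zero_of_prime_pow_smul_eq_zero_localFixedPointsOfEmb_kerSubgroup_padic κ ι W hp2 M hΔ hA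
    (hVM.trans hWV.symm)

end Torsion

/-! ## §3 `A₀ = A₀'` at `E = ℚ_p` with no auxiliary hypothesis -/

section Preimage

variable {p : ℕ} [hp : Fact p.Prime] {K : Type} [Field K] [NumberField K] [Algebra K ℚ_[p]]
  (κ : ZpExtension K p) (W : WeierstrassCurve K) [W.IsElliptic] (ε : ℤˣ)

/-- **B2 (`A₀ = A₀'`) hypothesis-free at `E = ℚ_p`, model form.** For `W/K` elliptic with a good
supersingular `ℤ_p`-model at the embedding `K → ℚ_p` (`Δ(M)` a unit, `A_p(M) ∈ pℤ_p`,
`M ⊗ ℚ̄_p = W ⊗ ℚ̄_p`), `p ≥ 3`, any `ℤ_p`-extension `κ` and sign `ε`: a class over `K` restricts into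
`Sel^{ε,str}(E/K_∞) = ⋃ₙ hₙ(Sel^{ε,str}(E/K_n))` (p17, model `ℚ_p`) iff its restriction to `K_∞`
satisfies the level-`∞` conditions (`Sel_{p^∞}(E/K_∞)` and the strict signed Kummer condition cut
out by `⋃ₙ E^{ε,str}(K_n·ℚ_p)` at every conjugate of the chosen embedding). File 47 with (hS) from §1
and (htors) from §2. [cite: Kobayashi2003, Def. 2.1 (p. 5), Prop. 8.7 (p. 16), Thm. 9.3 (p. 26)]
[cite: GreenbergLNM1716, §3 pp. 85–90] -/
theorem comap_layerToInfty_zero_strictSignedSelmerInfty_eq_padic (hp2 : p ≠ 2)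
    (M : WeierstrassCurve ℤ_[p]) (hΔ : IsUnit M.Δ)
    (hA : M.hasseCoeff p ∈ IsLocalRing.maximalIdeal ℤ_[p])
    (hWM : M.baseChange (AlgebraicClosure ℚ_[p]) = W.baseChange (AlgebraicClosure ℚ_[p])) :
    (strictSignedSelmerInfty W κ ℚ_[p] ε).comap (W.layerToInfty κ 0) =
      (W.selmerInfty κ ⊓
        ⨅ σ : Field.absoluteGaloisGroup K,
          (localKummerOverOfEmb W p κ.kerSubgroup (closureEmb (K := K) ℚ_[p])
              (⨆ m, strictSignedLocalPoints κ ℚ_[p] W ε m)).comap (W.conjH1 p κ.kerSubgroup σ)).comap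
        (W.layerToInfty κ 0) := by
  obtain ⟨S, hS⟩ := exists_finset_forall_not_mem_good W p
  exact comap_layerToInfty_zero_strictSignedSelmerInfty_eq W κ ℚ_[p] ε S hS
    (eq_zero_of_prime_pow_smul_eq_zero_localFixedPointsOfEmb_kerSubgroup_padic κ (closureEmb (K := K) ℚ_[p])
      W hp2 M hΔ hA hWM)

/-- **B2 (`A₀ = A₀'`) hypothesis-free at `E = ℚ_p`, for a globally minimal good supersingular `V/ℚ`
read over `K`** (`W ⊗ ℚ̄_p = V ⊗ ℚ̄_p`, `V.HasGoodReductionAtPrime p`, `a_p(V) = 0`, `p ≥ 3`). For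
`K = ℚ`, `W = V`, `κ` cyclotomic: Kobayashi's `Sel^±(E/ℚ_∞)` pulls back to `ℚ` as the Selmer group of
the pulled-back level-`∞` signed condition. [cite: Kobayashi2003, Def. 1.1 (p. 2), Def. 2.1 (p. 5), Prop. 8.7 (p. 16)]
[cite: GreenbergLNM1716, §3 pp. 85–90] -/
theorem comap_layerToInfty_zero_strictSignedSelmerInfty_eq_of_goodSupersingular (hp2 : p ≠ 2)
    (V : WeierstrassCurve ℚ) [V.IsElliptic] [V.IsGloballyMinimal]
    (hgood : V.HasGoodReductionAtPrime p) (hap : V.frobeniusTrace p = 0)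
    (hWV : W.baseChange (AlgebraicClosure ℚ_[p]) = V.baseChange (AlgebraicClosure ℚ_[p])) :
    (strictSignedSelmerInfty W κ ℚ_[p] ε).comap (W.layerToInfty κ 0) =
      (W.selmerInfty κ ⊓
        ⨅ σ : Field.absoluteGaloisGroup K,
          (localKummerOverOfEmb W p κ.kerSubgroup (closureEmb (K := K) ℚ_[p])
              (⨆ m, strictSignedLocalPoints κ ℚ_[p] W ε m)).comap (W.conjH1 p κ.kerSubgroup σ)).comap
        (W.layerToInfty κ 0) := by
  obtain ⟨M, hΔ, hA, hVM⟩ := exists_goodSupersingularPadicModel hp2 V hgood hap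
  exact comap_layerToInfty_zero_strictSignedSelmerInfty_eq_padic κ W ε hp2 M hΔ hA (hVM.trans hWV.symm)

omit [Algebra K ℚ_[p]] in
/-- **The kernel statement hypothesis-free up to the choice of `S`** (file 47 §2 read with (hS)
from §1): for `W/K` elliptic there is a finite set `S` of finite places such that, for every class
`y` over `K` with `h₀ y ∈ Sel_{p^∞}(E/K_∞)`, `y ∈ Sel^{ε,str}(E/K_0)` iff `y` dies in `H¹(K_v, E)` for
`v ∈ S` and satisfies the level-`0` strict signed Kummer condition at the chosen embedding (any
model `E`). [cite: GreenbergLNM1716, §3 Lemma 3.3 (pp. 86–87) and p. 90] [cite: Kobayashi2003, Def. 2.1 (p. 5)] -/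
theorem exists_finset_mem_strictSignedSelmerLayer_zero_iff (E : Type) [Field E] [Algebra K E] :
    ∃ S : Finset (HeightOneSpectrum (𝓞 K)), ∀ y : W.subgroupH1 p (κ.layerSubgroup 0),
      W.layerToInfty κ 0 y ∈ W.selmerInfty κ →
        (y ∈ strictSignedSelmerLayer W κ E ε 0 ↔
          (∀ v ∈ S, W.localResOver p (κ.layerSubgroup 0) (v.adicCompletion K) y = 0) ∧
            y ∈ localKummerOverOfEmb W p (κ.layerSubgroup 0) (closureEmb (K := K) E)
              (strictSignedLocalPoints κ E W ε 0)) := by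
  obtain ⟨S, hS⟩ := exists_finset_forall_not_mem_good W p
  exact ⟨S, fun y hsel ↦ mem_strictSignedSelmerLayer_zero_iff_of_layerToInfty_mem W κ E ε S hS hsel⟩

end Preimage

end Summit.BirchSwinnertonDyer.Rank1Residual.Additive

end
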